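import Summits.QuantumFields.BalabanUV.Beta.WardLocusCubic
import Summits.QuantumFields.BalabanUV.Beta.SpineRootedBmNWardRelInv
import Summits.QuantumFields.BalabanUV.Beta.LagrangeFold
import Literature.MathematicalPhysics.QuantumFieldTheory.Balaban1983to89.Beta.SecondOrderResponse

/-!
# `BalabanUV.Beta.KernelWardSwapResponse` — binder row D1, (L4) W-side: THE SWAPPED RESPONSE PIECE of the second-order Ward socket for the
# symmetrised carrier — the (μ,y)-divergence of `dM (K2OfK K N S M μ y) N S M ν y′` lands on the differentiated inverse's OWN bond and is the
# K-sandwich of the FIRST-ORDER Ward law; under the relative-inverse rules it is the ROTATED FIRST-ORDER VERTEX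
# (β sub-cell, D1 formalisation swarm, unit `b2b-balaban-beta-d1-formalise-leaf-10`, gen 2; CLAIM «D1-hW-L4-SWAP», part 2)

NOT IN PRINT; OUR BOOKKEEPING.  HONEST FRAMING (cell contract, verbatim): «discharging `BetaPertH` makes Bałaban's UV stability
UNCONDITIONAL — a real constructive-QFT result; it is NOT the continuum limit and NOT the Clay problem.»  HONEST DEPENDENCY (verbatim):
«continuum YM on T⁴ ⇐ BetaPertH ∧ nine spine estimates (0/9 proved); BetaPertH ⇐ (D1) ∧ (D4) ∧ CAP+tail; G-an2-4 gates asym, D1 and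
NE2/3/4.»  [folklore] kernel algebra; the first-order law, the relative-inverse rules and `[E, X y] = 0` are DISPLAYED HYPOTHESES; instantiates
NO binder of the β-function wall; no `[cite:]`, no `def`, no `def … : Prop`; NOT D1, NOT `BetaPertH`, NOT continuum, NOT Clay.

## What

In the swapped ordering of an2's carrier the response term is `dM (K2OfK K N S M μ y) N S M ν y′` (`K2OfK … μ y = −K∘dM_{(μ,y)}∘K`); its
pure-gauge divergence in `(μ, y)`:
* §1 `dM_kernel_finset_sum`/`dM_kernel_sub` — `dM` is additive in its KERNEL slot (entrywise; summabilities from `Loc` + bounded tables): `divW (μ y ν y′ ↦ dM (K2OfK … μ y) N S M ν y′) y ν y′ = dM (Σ_μ (K2OfK(μ, y−e_μ) − K2OfK(μ, y))) N S M ν y′`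
  (`divW_resp_swap_eq_dM`).
* §2 `sandwich_finset_sum`/`sandwich_sub` — the K-sandwich `D ↦ K∘D∘K` is additive over finite sums of differences of bounded kernels ⇒
  **`K2OfK_bondDiv`**: `Σ_μ (K2OfK(μ, y−e_μ) − K2OfK(μ, y)) = −K ∘ divV (dM K N S M) y ∘ K`.
* §3 under the FIRST-ORDER LAW `divV (dM K N S M) y = conjV 𝕄 (X y)` (an1's `KernelWardMColumn.divV_dM_eq_conjV` for the wall) and the relative
  rules `RelInv K 𝕄 E` with `[E, X y] = 0` (leaf-10 gen-1 `WardLocusCubic.comp_conjV_comp_rel`): `−K∘conjV 𝕄 (X y)∘K = conjV K (X y)`; and for a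
  DIAGONAL generator `X y = diagK g` (**`dM_conjV_diagK`**): `dM (conjV K (diagK g)) N S M ν y′ = vertexOfK K N (κ u ↦ (g (N•y′) (inr ν) − g u (inl κ)) • S κ u) ν y′
  + vertexOfM K N (ρ w ↦ (g (N•y′) (inr ν) − g (N•w) (inr ρ)) • M ρ w) ν y′` — THE ROTATED FIRST-ORDER VERTEX (scalar weights: row-parity of
  `S`, `M` is preserved, so an1's parity engine makes it tadpole-null; `Loc` is automatic).
* §4 assembled: **`divW_resp_swap_of_law`** and the wall instance over `G_j` (RelInv from an2's `relInv_coDressKBmAt_KInvStep_bhKStepAt_all`). -/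

noncomputable section

open Finset
open scoped BigOperators
open Literature.MathematicalPhysics.QuantumFieldTheory
open Literature.MathematicalPhysics.QuantumFieldTheory.Balaban1983to89
open Literature.MathematicalPhysics.QuantumFieldTheory.Balaban1983to89.Beta
open B6BondElimination (unitVec)
open B12Sec2to5 (l1 l1_nonneg)
open ExpKernelCalculus (MKer Decays BiLoc VertexFamily comp summable_exp_shift summable_exp_shift' Zl)
open KernelWard (divV divW bdd_of_biLoc bdd_of_decays)
open AffineAveraging (box toSite)
open OneStepResolventKernel (Fib wsum LocStencil)
open OneStepKernelFamily (KInvStep colH vertexOfK)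
open InterLevelTransport (cwsum cwsum_apply)
open SecondOrderResponse (colM vertexOfM dM K2OfK)
open Summit.QuantumFields.BalabanUV.Beta.TameKernelCalculus
open Summit.QuantumFields.BalabanUV.Beta.ChartConjugation (conjV)
open Summit.QuantumFields.BalabanUV.Beta.ChartConjugationRelative (RelInv)
open Summit.QuantumFields.BalabanUV.Beta.ChartConjugationReflection (summable_abs_colH)
open Summit.QuantumFields.BalabanUV.Beta.BorderedHessian (diagK comp_diagK_left comp_diagK_right bhKStepAt spr_bhKStepAt)
open Summit.QuantumFields.BalabanUV.Beta.AxialDressingRooted (axEc coDressKBmAt decays_coDressKBmAt_KInvStep spr_axEc)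
open Summit.QuantumFields.BalabanUV.Beta.WardLocusCubic (comp_conjV_comp_rel)
open Summit.QuantumFields.BalabanUV.Beta.LagrangeFold (summable_exp_zsmul)

namespace Summit.QuantumFields.BalabanUV.Beta.KernelWardSwapResponse

variable {d : ℕ} {N : ℕ}

/-! ## §1 `dM` is additive in its kernel slot; the swapped divergence as one `dM` -/

section KernelSlot

variable [NeZero N]

omit [NeZero N] in
/-- [folklore] Columns of a bi-localised kernel are absolutely summable against a bounded field table. -/
theorem summable_colH_mul_of_loc {A : MKer (d + 1) (Fib d)} (hA : Loc A)
    {S : Fin (d + 1) → (Fin (d + 1) → ℤ) → MKer (d + 1) (Fib d)} {B : ℝ} (hS : ∀ κ u x z a b, |S κ u x z a b| ≤ B)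
    (ν : Fin (d + 1)) (y' : Fin (d + 1) → ℤ) (κ : Fin (d + 1)) (x z : Fin (d + 1) → ℤ) (a b : Fib d) :
    Summable fun u => colH A N ν y' κ u * S κ u x z a b := by
  obtain ⟨p, q, C, δ, hδ, hAl⟩ := hA
  refine Summable.of_norm_bounded ((summable_exp_shift' hδ p).mul_left (C * |B|)) (fun u => ?_)
  rw [Real.norm_eq_abs, abs_mul]
  have h1 : |colH A N ν y' κ u| ≤ C * Real.exp (-δ * l1 (u - p)) := by
    refine (hAl u _ _ _).trans (mul_le_mul_of_nonneg_left ?_ (hAl.nonneg (Sum.inl 0)))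
    exact Real.exp_le_exp.mpr (by nlinarith [l1_nonneg ((N : ℤ) • y' - q), hδ])
  calc |colH A N ν y' κ u| * |S κ u x z a b| ≤ (C * Real.exp (-δ * l1 (u - p))) * |B| :=
        mul_le_mul h1 ((hS κ u x z a b).trans (le_abs_self B)) (abs_nonneg _) ((abs_nonneg _).trans h1)
    _ = C * |B| * Real.exp (-δ * l1 (u - p)) := by ring

/-- [folklore] Multiplier columns of a bi-localised kernel are absolutely summable against a bounded multiplier table. -/
theorem summable_colM_mul_of_loc {A : MKer (d + 1) (Fib d)} (hA : Loc A)
    {M : Fin (d + 1) → (Fin (d + 1) → ℤ) → MKer (d + 1) (Fib d)} {B : ℝ} (hM : ∀ ρ w x z a b, |M ρ w x z a b| ≤ B)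
    (ν : Fin (d + 1)) (y' : Fin (d + 1) → ℤ) (ρ : Fin (d + 1)) (x z : Fin (d + 1) → ℤ) (a b : Fib d) :
    Summable fun w => colM A N ν y' ρ w * M ρ w x z a b := by
  obtain ⟨p, q, C, δ, hδ, hAl⟩ := hA
  refine Summable.of_norm_bounded ((summable_exp_zsmul (N := N) hδ p).mul_left (C * |B|)) (fun w => ?_)
  rw [Real.norm_eq_abs, abs_mul]
  have h1 : |colM A N ν y' ρ w| ≤ C * Real.exp (-δ * l1 ((N : ℤ) • w - p)) := by
    refine (hAl _ _ _ _).trans (mul_le_mul_of_nonneg_left ?_ (hAl.nonneg (Sum.inl 0)))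
    exact Real.exp_le_exp.mpr (by nlinarith [l1_nonneg ((N : ℤ) • y' - q), hδ])
  calc |colM A N ν y' ρ w| * |M ρ w x z a b| ≤ (C * Real.exp (-δ * l1 ((N : ℤ) • w - p))) * |B| :=
        mul_le_mul h1 ((hM ρ w x z a b).trans (le_abs_self B)) (abs_nonneg _) ((abs_nonneg _).trans h1)
    _ = C * |B| * Real.exp (-δ * l1 ((N : ℤ) • w - p)) := by ring

/-- [folklore] **`dM` IS ADDITIVE IN ITS KERNEL SLOT over a finite sum** of bi-localised kernels (bounded tables):
`dM (Σ_{i∈s} A i) N S M ν y′ = Σ_{i∈s} dM (A i) N S M ν y′` (the kernel sum taken pointwise). -/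
theorem dM_kernel_finset_sum {ι : Type*} (s : Finset ι) {A : ι → MKer (d + 1) (Fib d)} (hA : ∀ i, Loc (A i))
    {S : Fin (d + 1) → (Fin (d + 1) → ℤ) → MKer (d + 1) (Fib d)} {B : ℝ} (hS : ∀ κ u x z a b, |S κ u x z a b| ≤ B)
    {M : Fin (d + 1) → (Fin (d + 1) → ℤ) → MKer (d + 1) (Fib d)} {BM : ℝ} (hM : ∀ ρ w x z a b, |M ρ w x z a b| ≤ BM)
    (ν : Fin (d + 1)) (y' : Fin (d + 1) → ℤ) :
    dM (fun x z a b => ∑ i ∈ s, A i x z a b) N S M ν y' = ∑ i ∈ s, dM (A i) N S M ν y' := by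
  classical
  funext x z a b
  simp only [Finset.sum_apply, SecondOrderResponse.dM, Pi.add_apply, vertexOfK, vertexOfM, OneStepResolventKernel.wsum, cwsum_apply,
    colH, colM, Finset.sum_mul]
  have hSk : ∀ i κ, Summable fun u => A i u ((N : ℤ) • y') (Sum.inl κ) (Sum.inr ν) * S κ u x z a b :=
    fun i κ => summable_colH_mul_of_loc (N := N) (hA i) hS ν y' κ x z a b
  have hMk : ∀ i ρ, Summable fun w => A i ((N : ℤ) • w) ((N : ℤ) • y') (Sum.inr ρ) (Sum.inr ν) * M ρ w x z a b :=
    fun i ρ => summable_colM_mul_of_loc (N := N) (hA i) hM ν y' ρ x z a b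
  rw [Finset.sum_add_distrib]
  congr 1
  · rw [Finset.sum_comm]
    exact Finset.sum_congr rfl fun κ _ => Summable.tsum_finsetSum (fun i _ => hSk i κ)
  · rw [Finset.sum_comm]
    exact Finset.sum_congr rfl fun ρ _ => Summable.tsum_finsetSum (fun i _ => hMk i ρ)

/-- [folklore] **`dM` IS SUBTRACTIVE IN ITS KERNEL SLOT**: `dM (A − A′) N S M ν y′ = dM A N S M ν y′ − dM A′ N S M ν y′` (bi-localised kernels,
bounded tables). -/
theorem dM_kernel_sub {A A' : MKer (d + 1) (Fib d)} (hA : Loc A) (hA' : Loc A')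
    {S : Fin (d + 1) → (Fin (d + 1) → ℤ) → MKer (d + 1) (Fib d)} {B : ℝ} (hS : ∀ κ u x z a b, |S κ u x z a b| ≤ B)
    {M : Fin (d + 1) → (Fin (d + 1) → ℤ) → MKer (d + 1) (Fib d)} {BM : ℝ} (hM : ∀ ρ w x z a b, |M ρ w x z a b| ≤ BM)
    (ν : Fin (d + 1)) (y' : Fin (d + 1) → ℤ) :
    dM (A - A') N S M ν y' = dM A N S M ν y' - dM A' N S M ν y' := by
  funext x z a b
  simp only [Pi.sub_apply, SecondOrderResponse.dM, Pi.add_apply, vertexOfK, vertexOfM, OneStepResolventKernel.wsum, cwsum_apply,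
    colH, colM, sub_mul]
  have hSk := fun κ => summable_colH_mul_of_loc (N := N) hA hS ν y' κ x z a b
  have hSk' := fun κ => summable_colH_mul_of_loc (N := N) hA' hS ν y' κ x z a b
  have hMk := fun ρ => summable_colM_mul_of_loc (N := N) hA hM ν y' ρ x z a b
  have hMk' := fun ρ => summable_colM_mul_of_loc (N := N) hA' hM ν y' ρ x z a b
  simp only [colH, colM] at hSk hSk' hMk hMk'
  rw [Finset.sum_congr rfl fun κ _ => (hSk κ).tsum_sub (hSk' κ), Finset.sum_congr rfl fun ρ _ => (hMk ρ).tsum_sub (hMk' ρ),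
    Finset.sum_sub_distrib, Finset.sum_sub_distrib]
  ring

/-- [folklore] **THE SWAPPED RESPONSE DIVERGENCE AS ONE `dM`**: for bi-localised differentiated inverses and bounded tables,
`divW (μ y ν y′ ↦ dM (K2OfK K N S M μ y) N S M ν y′) y ν y′ = dM (Σ_μ (K2OfK(μ, y − e_μ) − K2OfK(μ, y))) N S M ν y′`. -/
theorem divW_resp_swap_eq_dM {K : MKer (d + 1) (Fib d)}
    {S : Fin (d + 1) → (Fin (d + 1) → ℤ) → MKer (d + 1) (Fib d)} {B : ℝ} (hS : ∀ κ u x z a b, |S κ u x z a b| ≤ B)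
    {M : Fin (d + 1) → (Fin (d + 1) → ℤ) → MKer (d + 1) (Fib d)} {BM : ℝ} (hM : ∀ ρ w x z a b, |M ρ w x z a b| ≤ BM)
    (hK2 : ∀ μ y, Loc (K2OfK K N S M μ y)) (y : Fin (d + 1) → ℤ) (ν : Fin (d + 1)) (y' : Fin (d + 1) → ℤ) :
    divW (fun μ y ν y' => dM (K2OfK K N S M μ y) N S M ν y') y ν y' =
      dM (fun x z a b => ∑ μ, (K2OfK K N S M μ (y - unitVec μ) x z a b - K2OfK K N S M μ y x z a b)) N S M ν y' := by
  have hsub : ∀ μ, Loc (K2OfK K N S M μ (y - unitVec μ) - K2OfK K N S M μ y) := fun μ =>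
    (hK2 μ _).sub (hK2 μ y)
  have e : (fun x z a b => ∑ μ, (K2OfK K N S M μ (y - unitVec μ) x z a b - K2OfK K N S M μ y x z a b)) =
      fun x z a b => ∑ μ, (K2OfK K N S M μ (y - unitVec μ) - K2OfK K N S M μ y) x z a b := by
    funext x z a b; simp only [Pi.sub_apply]
  rw [e, dM_kernel_finset_sum Finset.univ hsub hS hM ν y']
  simp only [KernelWard.divW, dM_kernel_sub (hK2 _ _) (hK2 _ y) hS hM ν y']

end KernelSlot

/-! ## §2 The K-sandwich is additive; the bond divergence of the differentiated inverse -/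

section Sandwich

/-- [folklore] Entrywise bound of `K∘D` for decaying `K` and bounded `D`. -/
theorem abs_comp_le_of_bdd {K D : MKer (d + 1) (Fib d)} {C δ B : ℝ} (hK : Decays K C δ) (hδ : 0 < δ) (hD : ∀ x z a b, |D x z a b| ≤ B)
    (x z : Fin (d + 1) → ℤ) (a b : Fib d) : |comp K D x z a b| ≤ (Fintype.card (Fib d) : ℝ) * (C * Zl (d + 1) δ * |B|) := by
  unfold ExpKernelCalculus.comp
  have hs : ∀ f, Summable fun v => K x v a f * D v z f b := fun f =>
    Summable.of_norm_bounded ((summable_exp_shift hδ x).mul_left (C * |B|)) (fun v => by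
      rw [Real.norm_eq_abs, abs_mul]
      calc |K x v a f| * |D v z f b| ≤ (C * Real.exp (-δ * l1 (x - v))) * |B| :=
            mul_le_mul (hK x v a f) ((hD v z f b).trans (le_abs_self B)) (abs_nonneg _) ((abs_nonneg _).trans (hK x v a f))
        _ = C * |B| * Real.exp (-δ * l1 (x - v)) := by ring)
  rw [Summable.tsum_finsetSum (fun f _ => hs f)]
  calc |∑ f, ∑' v, K x v a f * D v z f b| ≤ ∑ f, |∑' v, K x v a f * D v z f b| := Finset.abs_sum_le_sum_abs _ _
    _ ≤ ∑ _f : Fib d, C * Zl (d + 1) δ * |B| := Finset.sum_le_sum fun f _ => by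
        calc |∑' v, K x v a f * D v z f b| ≤ ∑' v, |K x v a f * D v z f b| := by
              rw [← Real.norm_eq_abs]; exact norm_tsum_le_tsum_norm (hs f).abs
          _ ≤ ∑' v, C * |B| * Real.exp (-δ * l1 (x - v)) := (hs f).abs.tsum_le_tsum (fun v => by
                rw [abs_mul]
                calc |K x v a f| * |D v z f b| ≤ (C * Real.exp (-δ * l1 (x - v))) * |B| :=
                      mul_le_mul (hK x v a f) ((hD v z f b).trans (le_abs_self B)) (abs_nonneg _) ((abs_nonneg _).trans (hK x v a f))
                  _ = _ := by ring) ((summable_exp_shift hδ x).mul_left _)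
          _ = C * Zl (d + 1) δ * |B| := by rw [tsum_mul_left, ExpKernelCalculus.tsum_exp_shift]; ring
    _ = _ := by simp only [Finset.sum_const, Finset.card_univ, nsmul_eq_mul]

/-- [folklore] Row summability of `v ↦ Σ_g K x v a g · D v w g f` for decaying `K` and bounded `D`. -/
theorem summable_row_comp {K D : MKer (d + 1) (Fib d)} {C δ B : ℝ} (hK : Decays K C δ) (hδ : 0 < δ) (hD : ∀ x z a b, |D x z a b| ≤ B)
    (x w : Fin (d + 1) → ℤ) (a f : Fib d) : Summable fun v => ∑ g : Fib d, K x v a g * D v w g f :=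
  summable_sum fun g _ => Summable.of_norm_bounded ((summable_exp_shift hδ x).mul_left (C * |B|)) (fun v => by
    rw [Real.norm_eq_abs, abs_mul]
    calc |K x v a g| * |D v w g f| ≤ (C * Real.exp (-δ * l1 (x - v))) * |B| :=
          mul_le_mul (hK x v a g) ((hD v w g f).trans (le_abs_self B)) (abs_nonneg _) ((abs_nonneg _).trans (hK x v a g))
      _ = C * |B| * Real.exp (-δ * l1 (x - v)) := by ring)

/-- [folklore] Column summability of `w ↦ Σ_f (K∘D) x w a f · K w z f b` for decaying `K` and bounded `D`. -/
theorem summable_comp_col {K D : MKer (d + 1) (Fib d)} {C δ B : ℝ} (hK : Decays K C δ) (hδ : 0 < δ) (hD : ∀ x z a b, |D x z a b| ≤ B)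
    (x z : Fin (d + 1) → ℤ) (a b : Fib d) : Summable fun w => ∑ f : Fib d, comp K D x w a f * K w z f b := by
  have hB := abs_comp_le_of_bdd hK hδ hD
  set B' : ℝ := (Fintype.card (Fib d) : ℝ) * (C * Zl (d + 1) δ * |B|)
  exact summable_sum fun f _ => Summable.of_norm_bounded ((summable_exp_shift' hδ z).mul_left (|B'| * C)) (fun w => by
    rw [Real.norm_eq_abs, abs_mul]
    calc |comp K D x w a f| * |K w z f b| ≤ |B'| * (C * Real.exp (-δ * l1 (w - z))) :=
          mul_le_mul ((hB x w a f).trans (le_abs_self _)) (hK w z f b) (abs_nonneg _) (abs_nonneg _)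
      _ = |B'| * C * Real.exp (-δ * l1 (w - z)) := by ring)

/-- [folklore] **THE K-SANDWICH IS ADDITIVE over a finite sum** of bounded kernels (decaying `K`):
`K ∘ (Σ_{i∈s} D i) ∘ K = Σ_{i∈s} K∘D i∘K` (kernel sum pointwise; only `tsum` linearity). -/
theorem sandwich_finset_sum {ι : Type*} (s : Finset ι) {K : MKer (d + 1) (Fib d)} (hK : ∃ δ C : ℝ, 0 < δ ∧ 0 ≤ C ∧ Decays K C δ)
    {D : ι → MKer (d + 1) (Fib d)} (hD : ∀ i, ∃ B : ℝ, ∀ x z a b, |D i x z a b| ≤ B) :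
    comp (comp K (fun x z a b => ∑ i ∈ s, D i x z a b)) K = fun x z a b => ∑ i ∈ s, comp (comp K (D i)) K x z a b := by
  classical
  obtain ⟨δ, C, hδ, hC, hKd⟩ := hK
  have hs1 : ∀ i x w a f, Summable fun v => ∑ g : Fib d, K x v a g * D i v w g f := fun i x w a f => by
    obtain ⟨B, hB⟩ := hD i; exact summable_row_comp hKd hδ hB x w a f
  have hs2 : ∀ i x z a b, Summable fun w => ∑ f : Fib d, comp K (D i) x w a f * K w z f b := fun i x z a b => by
    obtain ⟨B, hB⟩ := hD i; exact summable_comp_col hKd hδ hB x z a b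
  have step1 : ∀ x w a f, comp K (fun x z a b => ∑ i ∈ s, D i x z a b) x w a f = ∑ i ∈ s, comp K (D i) x w a f := by
    intro x w a f
    show (∑' v, ∑ g : Fib d, K x v a g * (∑ i ∈ s, D i v w g f)) = ∑ i ∈ s, ∑' v, ∑ g : Fib d, K x v a g * D i v w g f
    have e : ∀ v, ∑ g : Fib d, K x v a g * (∑ i ∈ s, D i v w g f) = ∑ i ∈ s, ∑ g : Fib d, K x v a g * D i v w g f := by
      intro v; simp only [Finset.mul_sum]; exact Finset.sum_comm
    simp only [e]
    exact Summable.tsum_finsetSum (fun i _ => hs1 i x w a f)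
  funext x z a b
  show (∑' w, ∑ f : Fib d, comp K (fun x z a b => ∑ i ∈ s, D i x z a b) x w a f * K w z f b) = _
  have e2 : ∀ w, ∑ f : Fib d, comp K (fun x z a b => ∑ i ∈ s, D i x z a b) x w a f * K w z f b =
      ∑ i ∈ s, ∑ f : Fib d, comp K (D i) x w a f * K w z f b := by
    intro w; simp only [step1, Finset.sum_mul]; exact Finset.sum_comm
  simp only [e2]
  rw [Summable.tsum_finsetSum (fun i _ => hs2 i x z a b)]
  rfl

/-- [folklore] **THE K-SANDWICH IS SUBTRACTIVE**: `K∘(D − D′)∘K = K∘D∘K − K∘D′∘K` for bounded `D`, `D′` (decaying `K`). -/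
theorem sandwich_sub {K : MKer (d + 1) (Fib d)} (hK : ∃ δ C : ℝ, 0 < δ ∧ 0 ≤ C ∧ Decays K C δ)
    {D D' : MKer (d + 1) (Fib d)} (hD : ∃ B : ℝ, ∀ x z a b, |D x z a b| ≤ B) (hD' : ∃ B : ℝ, ∀ x z a b, |D' x z a b| ≤ B) :
    comp (comp K (D - D')) K = comp (comp K D) K - comp (comp K D') K := by
  obtain ⟨δ, C, hδ, hC, hKd⟩ := hK
  obtain ⟨B, hB⟩ := hD
  obtain ⟨B', hB'⟩ := hD'
  have step1 : comp K (D - D') = comp K D - comp K D' := by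
    funext x w a f
    show (∑' v, ∑ g : Fib d, K x v a g * (D - D') v w g f) = (∑' v, ∑ g : Fib d, K x v a g * D v w g f) - ∑' v, ∑ g, K x v a g * D' v w g f
    rw [← (summable_row_comp hKd hδ hB x w a f).tsum_sub (summable_row_comp hKd hδ hB' x w a f)]
    refine tsum_congr fun v => ?_
    rw [← Finset.sum_sub_distrib]
    exact Finset.sum_congr rfl fun g _ => by simp only [Pi.sub_apply]; ring
  rw [step1]
  funext x z a b
  show (∑' w, ∑ f : Fib d, (comp K D - comp K D') x w a f * K w z f b) = (∑' w, ∑ f, comp K D x w a f * K w z f b) - ∑' w, ∑ f, comp K D' x w a f * K w z f b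
  rw [← (summable_comp_col hKd hδ hB x z a b).tsum_sub (summable_comp_col hKd hδ hB' x z a b)]
  refine tsum_congr fun w => ?_
  rw [← Finset.sum_sub_distrib]
  exact Finset.sum_congr rfl fun f _ => by simp only [Pi.sub_apply]; ring

/-- [folklore] **THE BOND DIVERGENCE OF THE DIFFERENTIATED INVERSE IS THE K-SANDWICH OF THE FIRST-ORDER DIVERGENCE**:
`Σ_μ (K2OfK K N S M μ (y − e_μ) − K2OfK K N S M μ y) = −K ∘ divV (dM K N S M) y ∘ K` (as kernels; `K` decaying, every `dM` bounded). -/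
theorem K2OfK_bondDiv {K : MKer (d + 1) (Fib d)} (hK : ∃ δ C : ℝ, 0 < δ ∧ 0 ≤ C ∧ Decays K C δ)
    {S M : Fin (d + 1) → (Fin (d + 1) → ℤ) → MKer (d + 1) (Fib d)} (hDb : ∀ μ y, ∃ B : ℝ, ∀ x z a b, |dM K N S M μ y x z a b| ≤ B)
    (y : Fin (d + 1) → ℤ) :
    (fun x z a b => ∑ μ, (K2OfK K N S M μ (y - unitVec μ) x z a b - K2OfK K N S M μ y x z a b)) =
      -comp (comp K (divV (dM K N S M) y)) K := by
  have hdiv : divV (dM K N S M) y = fun x z a b => ∑ μ, (dM K N S M μ (y - unitVec μ) - dM K N S M μ y) x z a b := by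
    funext x z a b; simp only [KernelWard.divV, Finset.sum_apply]
  have hsubB : ∀ μ, ∃ B : ℝ, ∀ x z a b, |(dM K N S M μ (y - unitVec μ) - dM K N S M μ y) x z a b| ≤ B := fun μ => by
    obtain ⟨B₁, h₁⟩ := hDb μ (y - unitVec μ)
    obtain ⟨B₂, h₂⟩ := hDb μ y
    exact ⟨B₁ + B₂, fun x z a b => by rw [Pi.sub_apply]; exact (abs_sub _ _).trans (add_le_add (h₁ x z a b) (h₂ x z a b))⟩
  rw [hdiv, sandwich_finset_sum Finset.univ hK hsubB]
  funext x z a b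
  simp only [Pi.neg_apply, ← Finset.sum_neg_distrib]
  refine Finset.sum_congr rfl fun μ _ => ?_
  rw [sandwich_sub hK (hDb μ _) (hDb μ y)]
  simp only [Pi.sub_apply, SecondOrderResponse.K2OfK]
  ring

end Sandwich

/-! ## §3 The first-order law, the relative rules, and the rotated first-order vertex -/

section Law

/-- [folklore] **UNDER THE RELATIVE RULES THE SANDWICH OF THE WARD COMMUTATOR IS A COMMUTATOR WITH `K`**: `RelInv K 𝕄 E`, `[E, X] = 0`, spread
`K, 𝕄, E`, localised `X` ⇒ `−K∘conjV 𝕄 X∘K = conjV K X` (leaf-10 gen-1 `WardLocusCubic.comp_conjV_comp_rel`). -/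
theorem neg_sandwich_conjV_eq_conjV {K 𝕄 E X : MKer (d + 1) (Fib d)} (hK : Spr K) (h𝕄 : Spr 𝕄) (hE : Spr E) (hR : RelInv K 𝕄 E)
    (hX : Loc X) (hEX : comp E X = comp X E) : -comp (comp K (conjV 𝕄 X)) K = conjV K X := by
  rw [comp_conjV_comp_rel hK h𝕄 hE hR hX hEX]
  unfold ChartConjugation.conjV
  abel

variable [NeZero N]

omit [NeZero N] in
/-- [folklore] The `ℋ`-column of the commutator of `K` with a diagonal kernel: the column of `K` times the DIFFERENCE of the diagonal weights at
the two legs. -/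
theorem colH_conjV_diagK (K : MKer (d + 1) (Fib d)) (g : (Fin (d + 1) → ℤ) → Fib d → ℝ) (ν : Fin (d + 1)) (y' : Fin (d + 1) → ℤ)
    (κ : Fin (d + 1)) (u : Fin (d + 1) → ℤ) :
    colH (conjV K (diagK g)) N ν y' κ u = colH K N ν y' κ u * (g ((N : ℤ) • y') (Sum.inr ν) - g u (Sum.inl κ)) := by
  simp only [colH, ChartConjugation.conjV, Pi.sub_apply, comp_diagK_right, comp_diagK_left]
  ring

omit [NeZero N] in
/-- [folklore] The multiplier column of the commutator of `K` with a diagonal kernel. -/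
theorem colM_conjV_diagK (K : MKer (d + 1) (Fib d)) (g : (Fin (d + 1) → ℤ) → Fib d → ℝ) (ν : Fin (d + 1)) (y' : Fin (d + 1) → ℤ)
    (ρ : Fin (d + 1)) (w : Fin (d + 1) → ℤ) :
    colM (conjV K (diagK g)) N ν y' ρ w = colM K N ν y' ρ w * (g ((N : ℤ) • y') (Sum.inr ν) - g ((N : ℤ) • w) (Sum.inr ρ)) := by
  simp only [colM, ChartConjugation.conjV, Pi.sub_apply, comp_diagK_right, comp_diagK_left]
  ring

/-- [folklore] **THE LAGRANGIAN-CHART VERTEX OF A COMMUTATOR `[K, diag g]` IS THE ROTATED FIRST-ORDER VERTEX**: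
`dM (conjV K (diagK g)) N S M ν y′ = vertexOfK K N (κ u ↦ (g (N•y′) (inr ν) − g u (inl κ)) • S κ u) ν y′
 + vertexOfM K N (ρ w ↦ (g (N•y′) (inr ν) − g (N•w) (inr ρ)) • M ρ w) ν y′` — scalar weights on the tables (row parity preserved). -/
theorem dM_conjV_diagK (K : MKer (d + 1) (Fib d)) (g : (Fin (d + 1) → ℤ) → Fib d → ℝ)
    (S M : Fin (d + 1) → (Fin (d + 1) → ℤ) → MKer (d + 1) (Fib d)) (ν : Fin (d + 1)) (y' : Fin (d + 1) → ℤ) :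
    dM (conjV K (diagK g)) N S M ν y' =
      vertexOfK K N (fun κ u => (g ((N : ℤ) • y') (Sum.inr ν) - g u (Sum.inl κ)) • S κ u) ν y'
        + vertexOfM K N (fun ρ w => (g ((N : ℤ) • y') (Sum.inr ν) - g ((N : ℤ) • w) (Sum.inr ρ)) • M ρ w) ν y' := by
  funext x z a b
  simp only [SecondOrderResponse.dM, Pi.add_apply, vertexOfK, vertexOfM, OneStepResolventKernel.wsum, cwsum_apply, colH_conjV_diagK,
    colM_conjV_diagK, Pi.smul_apply, smul_eq_mul]
  congr 1
  · exact Finset.sum_congr rfl fun κ _ => tsum_congr fun u => by ring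
  · exact Finset.sum_congr rfl fun ρ _ => tsum_congr fun w => by ring

end Law

/-! ## §4 The swapped response piece, assembled; the wall instance -/

section Assembly

variable [NeZero N]

/-- [folklore] **THE SWAPPED RESPONSE PIECE OF THE SECOND-ORDER WARD SOCKET.**  For a decaying `K` that is a relative inverse of `𝕄` on the range
of `E` (`RelInv K 𝕄 E`), a LOCAL first-order table `S` and a COARSE-LOCAL multiplier table `M` (common rate), the FIRST-ORDER Ward law
`divV (dM K N S M) y = conjV 𝕄 (X y)` for a localised generator commuting with `E`:
`divW (μ y ν y′ ↦ dM (K2OfK K N S M μ y) N S M ν y′) y ν y′ = dM (conjV K (X y)) N S M ν y′`. -/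
theorem divW_resp_swap_of_law {K 𝕄 E : MKer (d + 1) (Fib d)} {C m : ℝ} (hKd : Decays K C m) (hC : 0 ≤ C) (hm : 0 < m)
    (h𝕄 : Spr 𝕄) (hE : Spr E) (hR : RelInv K 𝕄 E)
    {S : Fin (d + 1) → (Fin (d + 1) → ℤ) → MKer (d + 1) (Fib d)} {Cs : ℝ} (hS : LocStencil S Cs m)
    {M : Fin (d + 1) → (Fin (d + 1) → ℤ) → MKer (d + 1) (Fib d)} {CM : ℝ} (hM : VertexFamily M N CM m)
    {X : (Fin (d + 1) → ℤ) → MKer (d + 1) (Fib d)} (hX : ∀ y, Loc (X y)) (hEX : ∀ y, comp E (X y) = comp (X y) E)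
    (hD : ∀ y, divV (dM K N S M) y = conjV 𝕄 (X y)) (y : Fin (d + 1) → ℤ) (ν : Fin (d + 1)) (y' : Fin (d + 1) → ℤ) :
    divW (fun μ y ν y' => dM (K2OfK K N S M μ y) N S M ν y') y ν y' = dM (conjV K (X y)) N S M ν y' := by
  have hK : ∃ δ C : ℝ, 0 < δ ∧ 0 ≤ C ∧ Decays K C δ := ⟨m, C, hm, hC, hKd⟩
  have hKs : Spr K := ⟨C, m, hm, hKd⟩
  have hSb : ∀ κ u x z a b, |S κ u x z a b| ≤ Cs := ChartConjugationReflection.abs_le_of_locStencil hS hm.le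
  have hMb : ∀ ρ w x z a b, |M ρ w x z a b| ≤ CM := fun ρ w x z a b => bdd_of_biLoc (hM ρ w) hm.le x z a b
  have hDv := SecondOrderResponse.vertexFamily_dM hKd hC hS hM hm le_rfl
  have hDb : ∀ μ y, ∃ B : ℝ, ∀ x z a b, |dM K N S M μ y x z a b| ≤ B := fun μ y =>
    ⟨_, fun x z a b => bdd_of_biLoc (hDv μ y) (half_pos hm).le x z a b⟩
  have hK2v := SecondOrderResponse.vertexFamily_K2OfK hKd hC hm hS hM
  have hK2 : ∀ μ y, Loc (K2OfK K N S M μ y) := fun μ y => ⟨_, _, _, _, by positivity, hK2v μ y⟩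
  rw [divW_resp_swap_eq_dM hSb hMb hK2 y ν y', K2OfK_bondDiv hK hDb y, hD y, neg_sandwich_conjV_eq_conjV hKs h𝕄 hE hR (hX y) (hEX y)]

/-- [folklore] **… WITH A DIAGONAL GENERATOR: THE ROTATED FIRST-ORDER VERTEX.**  Same hypotheses with `X y = diagK (g y)`:
`divW (μ y ν y′ ↦ dM (K2OfK K N S M μ y) N S M ν y′) y ν y′
 = vertexOfK K N (κ u ↦ (g y (N•y′) (inr ν) − g y u (inl κ)) • S κ u) ν y′ + vertexOfM K N (ρ w ↦ (g y (N•y′) (inr ν) − g y (N•w) (inr ρ)) • M ρ w) ν y′`. -/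
theorem divW_resp_swap_of_law_diag {K 𝕄 E : MKer (d + 1) (Fib d)} {C m : ℝ} (hKd : Decays K C m) (hC : 0 ≤ C) (hm : 0 < m)
    (h𝕄 : Spr 𝕄) (hE : Spr E) (hR : RelInv K 𝕄 E)
    {S : Fin (d + 1) → (Fin (d + 1) → ℤ) → MKer (d + 1) (Fib d)} {Cs : ℝ} (hS : LocStencil S Cs m)
    {M : Fin (d + 1) → (Fin (d + 1) → ℤ) → MKer (d + 1) (Fib d)} {CM : ℝ} (hM : VertexFamily M N CM m)
    {g : (Fin (d + 1) → ℤ) → (Fin (d + 1) → ℤ) → Fib d → ℝ} (hX : ∀ y, Loc (diagK (g y)))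
    (hEX : ∀ y, comp E (diagK (g y)) = comp (diagK (g y)) E)
    (hD : ∀ y, divV (dM K N S M) y = conjV 𝕄 (diagK (g y))) (y : Fin (d + 1) → ℤ) (ν : Fin (d + 1)) (y' : Fin (d + 1) → ℤ) :
    divW (fun μ y ν y' => dM (K2OfK K N S M μ y) N S M ν y') y ν y' =
      vertexOfK K N (fun κ u => (g y ((N : ℤ) • y') (Sum.inr ν) - g y u (Sum.inl κ)) • S κ u) ν y'
        + vertexOfM K N (fun ρ w => (g y ((N : ℤ) • y') (Sum.inr ν) - g y ((N : ℤ) • w) (Sum.inr ρ)) • M ρ w) ν y' := by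
  rw [divW_resp_swap_of_law hKd hC hm h𝕄 hE hR hS hM hX hEX hD y ν y', dM_conjV_diagK]

end Assembly

/-! ## §5 The wall instance over `G_j = coDressKBmAt (toSite r) Lc (KInvStep Lc j)` -/

section Wall

variable {Lc : ℕ} [NeZero Lc] {r : Fin (d + 1) → ℕ}

/-- [folklore] **THE SWAPPED RESPONSE PIECE OVER THE WALL'S STEP PROPAGATOR**, every level `j`, every in-block root `r`: the relative rules
are an2's `relInv_coDressKBmAt_KInvStep_bhKStepAt_all hr j` (against `bhKStepAt j`, on the range of `axEc`); the FIRST-ORDER law for `dM` and the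
commutation of the (diagonal) generator with `axEc` stay DISPLAYED hypotheses. -/
theorem divW_resp_swap_coDressKBmAt_KInvStep_of_law_diag (hr : r ∈ box (d + 1) Lc) (j : ℕ) {C m : ℝ}
    (hKd : Decays (coDressKBmAt (toSite r) Lc (KInvStep (d := d) Lc j)) C m) (hC : 0 ≤ C) (hm : 0 < m)
    {S : Fin (d + 1) → (Fin (d + 1) → ℤ) → MKer (d + 1) (Fib d)} {Cs : ℝ} (hS : LocStencil S Cs m)
    {M : Fin (d + 1) → (Fin (d + 1) → ℤ) → MKer (d + 1) (Fib d)} {CM : ℝ} (hM : VertexFamily M Lc CM m)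
    {g : (Fin (d + 1) → ℤ) → (Fin (d + 1) → ℤ) → Fib d → ℝ} (hX : ∀ y, Loc (diagK (g y)))
    (hEX : ∀ y, comp (axEc (toSite r) Lc) (diagK (g y)) = comp (diagK (g y)) (axEc (toSite r) Lc))
    (hD : ∀ y, divV (dM (coDressKBmAt (toSite r) Lc (KInvStep (d := d) Lc j)) Lc S M) y = conjV (bhKStepAt d (toSite r) Lc j) (diagK (g y)))
    (y : Fin (d + 1) → ℤ) (ν : Fin (d + 1)) (y' : Fin (d + 1) → ℤ) :
    divW (fun μ y ν y' => dM (K2OfK (coDressKBmAt (toSite r) Lc (KInvStep (d := d) Lc j)) Lc S M μ y) Lc S M ν y') y ν y' =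
      vertexOfK (coDressKBmAt (toSite r) Lc (KInvStep (d := d) Lc j)) Lc
          (fun κ u => (g y ((Lc : ℤ) • y') (Sum.inr ν) - g y u (Sum.inl κ)) • S κ u) ν y'
        + vertexOfM (coDressKBmAt (toSite r) Lc (KInvStep (d := d) Lc j)) Lc
          (fun ρ w => (g y ((Lc : ℤ) • y') (Sum.inr ν) - g y ((Lc : ℤ) • w) (Sum.inr ρ)) • M ρ w) ν y' :=
  divW_resp_swap_of_law_diag hKd hC hm (spr_bhKStepAt (d := d) hr j) (spr_axEc (toSite r) Lc)
    (SpineRooted.relInv_coDressKBmAt_KInvStep_bhKStepAt_all hr j) hS hM hX hEX hD y ν y'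

end Wall

end Summit.QuantumFields.BalabanUV.Beta.KernelWardSwapResponse

end
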